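import Summits.QuantumFields.YangMills.Theorems.Instrument.ClosedComplexKraftWeighted
import Mathlib.Combinatorics.Enumerative.Catalan.Basic
import HarnessLib

/-!
# Instrument cell `ym-instrument`, crew (b), R″ (d) INSTANCES of the degree-charged Kraft machine: the RANK charge `θ = 21/10` at `(83/500, 69/100)` ⇒ `(533/1000)·(9169/500)ⁿ`;
# the HILBERT–SCHMIDT charge `√θ ≤ 3623/2500` at `(171/1000, 71/100)` ⇒ `(14/25)·(817/50)ⁿ`; the CATALAN parity weight (19354-4's `KraftB`) at `(7/32, 13/17)` ⇒ `(4/5)·(41/4)ⁿ`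

QUESTIONS.md: Q-B1 ∕ P-B7 STEP-2 (ii) (sc-plan 03:49:39Z ∕ 03:57:39Z (3): constants OF RECORD; sc-ref REFEREE §6.62 REPLAY PASS of the certificates); sc-ref's R″ (d)
(R-DOUBLEPRIME.md 1058aa987410813e); planner ym-cruxidea-19354-4 `KraftB` (CruxIdea4UColumn.lean).  Cell `run/shared/lean/pub/ym-instrument/`, HUMAN RULING D-0084 (2),
director-ym R138.  HONEST FRAMING (page 1, binding).  WHAT IS CERTIFIED HERE: PURE COMBINATORICS of closed link-connected plaquette complexes of `ℤ⁴` (`Adm = ⊤`: every link is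
decided, `ClosedComplexTailBound.validFamily (fun _ => True) e n` = the closed link-connected `n`-complexes through `e`, cf. `closedCount_eq_admClosedCount`).  For each of the three
weight systems the 28 block inequalities and the root bound are decided by `norm_num` on explicit rationals (the certificates printed on the bus 03:38:29Z ∕ 03:44:34Z, §4 of
LEMMA-ucolumn-tail), and `ClosedComplexKraftWeighted.weightedCount_le` gives: ★ `chargedCount_rank_le`: `Σ_X Π_ℓ (21/10)^{(deg_X ℓ − 3)⁺} ≤ (533/1000)·(9169/500)ⁿ` — R″ (d)'s
TAIL OF RECORD (`column_of_record = rank`), now a tree theorem; ★ `chargedCount_hs_le`: `Σ_X Π_ℓ (3623/2500)^{(deg_X ℓ − 3)⁺} ≤ (14/25)·(817/50)ⁿ` (the `hs` alternate);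
★ `chargedCount_catalan_le`: `Σ_X Π_ℓ Cat½(deg_X ℓ) ≤ (4/5)·(41/4)ⁿ`, `Cat½(k) = [k even]·Catalan(k/2)` (19354-4's `KraftB`∕`DegreeWeightedTailB` shape).  `(k − 3)⁺` is
natural-number subtraction.  What these sums MEAN for the u-column rows (R″ (a)–(c), (e)) is paper-level and NOT typed here; no number here is a β, a radius or a rate; NOT
summit-bearing.  Grade (T).
-/

noncomputable section

open Finset
open Literature.MathematicalPhysics.QuantumLattice (ZdEdge ZdPlaquette plaquetteEdges)
open Literature.MathematicalPhysics.QuantumFieldTheory.Balaban1983to89.StrongCouplingKPWindow (links)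
open Summit.QuantumFields.YangMills.Theorems.Instrument.ClosedComplexExploration (atLink)
open Summit.QuantumFields.YangMills.Theorems.Instrument.ClosedComplexTailBound (validFamily)
open Summit.QuantumFields.YangMills.Theorems.Instrument.ClosedComplexKraftWeighted

namespace Summit.QuantumFields.YangMills.Theorems.Instrument.ChargedKraftInstances

/-! ## §1 The RANK charge of record: `g(k) = (21/10)^{(k−3)⁺}`, `(x, y) = (83/500, 69/100)` -/

/-- Rank-charge weights of record (sc-plan 03:49:39Z (ii)). [folklore] -/
def rankW : Weights := ⟨83 / 500, 69 / 100, fun k => (21 / 10 : ℝ) ^ (k - 3), by norm_num, by norm_num, by norm_num, fun k => by positivity⟩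

/-- The 28 block inequalities at the rank charge (binding: `S₂ = 0.99930`, `S₆ = 0.99943`). [folklore] -/
theorem rankW_block : BlockIneq rankW := by
  intro c a hca
  have hc : c ≤ 6 := by omega
  have ha : a ≤ 6 := by omega
  interval_cases c <;> interval_cases a <;> first | omega | norm_num [sum_range_succ, bwg, rankW, Nat.choose]

/-- The root bound `G = 533/1000` at the rank charge (`0.532274…`). [folklore] -/
theorem rankW_root : RootBound rankW (533 / 1000) := by
  intro a ha
  interval_cases a <;> norm_num [sum_range_succ, bwg, rankW, Nat.choose]

/-- The growth constant `1/(x y³) = 500000000/27266247 = 18.3377… ≤ 9169/500`. [folklore] -/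
theorem rankW_growth : (rankW.x * rankW.y ^ 3)⁻¹ ≤ 9169 / 500 := by norm_num [rankW]

/-- ★★ **R″ (d) TAIL OF RECORD**: through every link `e`, `Σ_{X closed link-connected ∋ e, |X| = n} Π_{ℓ ∈ links X} (21/10)^{(deg_X ℓ − 3)⁺} ≤ (533/1000)·(9169/500)ⁿ`. [folklore] -/
theorem chargedCount_rank_le (e : ZdEdge 4) (n : ℕ) :
    ∑ X ∈ validFamily (fun _ => True) e n, ∏ l ∈ links X, (21 / 10 : ℝ) ^ ((atLink X l).card - 3) ≤ 533 / 1000 * (9169 / 500 : ℝ) ^ n := by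
  classical
  have h := weightedCount_le rankW (fun _ => True) rankW_block rankW_root (e := e) trivial n
  unfold weightedCount at h
  simp_rw [charge_empty, filter_true_of_mem (fun _ _ => trivial)] at h
  exact h.trans (mul_le_mul_of_nonneg_left (pow_le_pow_left₀ (by norm_num [rankW]) rankW_growth n) (by norm_num))

/-! ## §2 The HILBERT–SCHMIDT charge: `g(k) = (3623/2500)^{(k−3)⁺}` (`3623/2500 ≥ √(21/10)`), `(x, y) = (171/1000, 71/100)` -/

/-- Hilbert–Schmidt-charge weights (sc-lean-1 03:44:34Z alternate). [folklore] -/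
def hsW : Weights := ⟨171 / 1000, 71 / 100, fun k => (3623 / 2500 : ℝ) ^ (k - 3), by norm_num, by norm_num, by norm_num, fun k => by positivity⟩

/-- `(3623/2500)² ≥ 21/10`: the base dominates `√θ`. [folklore] -/
theorem hsW_base_sq : (21 / 10 : ℝ) ≤ (3623 / 2500 : ℝ) ^ 2 := by norm_num

/-- The 28 block inequalities at the HS charge (binding: `S₂ = 0.99956`). [folklore] -/
theorem hsW_block : BlockIneq hsW := by
  intro c a hca
  have hc : c ≤ 6 := by omega
  have ha : a ≤ 6 := by omega
  interval_cases c <;> interval_cases a <;> first | omega | norm_num [sum_range_succ, bwg, hsW, Nat.choose]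

/-- The root bound `G = 14/25` at the HS charge (`0.559125…`). [folklore] -/
theorem hsW_root : RootBound hsW (14 / 25) := by
  intro a ha
  interval_cases a <;> norm_num [sum_range_succ, bwg, hsW, Nat.choose]

/-- The growth constant `1/(x y³) = 16.3391… ≤ 817/50`. [folklore] -/
theorem hsW_growth : (hsW.x * hsW.y ^ 3)⁻¹ ≤ 817 / 50 := by norm_num [hsW]

/-- ★ **R″ (d), `hs` alternate**: `Σ_X Π_ℓ (3623/2500)^{(deg_X ℓ − 3)⁺} ≤ (14/25)·(817/50)ⁿ`. [folklore] -/
theorem chargedCount_hs_le (e : ZdEdge 4) (n : ℕ) :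
    ∑ X ∈ validFamily (fun _ => True) e n, ∏ l ∈ links X, (3623 / 2500 : ℝ) ^ ((atLink X l).card - 3) ≤ 14 / 25 * (817 / 50 : ℝ) ^ n := by
  classical
  have h := weightedCount_le hsW (fun _ => True) hsW_block hsW_root (e := e) trivial n
  unfold weightedCount at h
  simp_rw [charge_empty, filter_true_of_mem (fun _ _ => trivial)] at h
  exact h.trans (mul_le_mul_of_nonneg_left (pow_le_pow_left₀ (by norm_num [hsW]) hsW_growth n) (by norm_num))

/-! ## §3 The CATALAN parity weight (planner 19354-4's `KraftB`): `g(k) = [k even]·Catalan(k/2)`, `(x, y) = (7/32, 13/17)` -/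

/-- `Cat½(k) = [k even]·Catalan(k/2)` (the pairing count of `k` fundamental `SU(2)` lines; `0` for odd `k`). [folklore] -/
def catalanHalf (k : ℕ) : ℕ := if Even k then catalan (k / 2) else 0

/-- `Cat½(0) = 1`. [folklore] -/
theorem catalanHalf_zero : catalanHalf 0 = 1 := by simp [catalanHalf, catalan_zero]
/-- `Cat½(1) = 0`. [folklore] -/
theorem catalanHalf_one : catalanHalf 1 = 0 := by simp [catalanHalf]
/-- `Cat½(2) = 1`. [folklore] -/
theorem catalanHalf_two : catalanHalf 2 = 1 := by simp [catalanHalf, catalan_one]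
/-- `Cat½(3) = 0`. [folklore] -/
theorem catalanHalf_three : catalanHalf 3 = 0 := by
  have : ¬ Even 3 := by decide
  simp [catalanHalf, this]
/-- `Cat½(4) = 2`. [folklore] -/
theorem catalanHalf_four : catalanHalf 4 = 2 := by
  have : Even 4 := by decide
  simp [catalanHalf, this, catalan_two]
/-- `Cat½(5) = 0`. [folklore] -/
theorem catalanHalf_five : catalanHalf 5 = 0 := by
  have : ¬ Even 5 := by decide
  simp [catalanHalf, this]
/-- `Cat½(6) = 5`. [folklore] -/
theorem catalanHalf_six : catalanHalf 6 = 5 := by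
  have : Even 6 := by decide
  simp [catalanHalf, this, catalan_three]

/-- Catalan-parity weights at `(7/32, 13/17)` (19354-4's certified point). [folklore] -/
def catW : Weights := ⟨7 / 32, 13 / 17, fun k => (catalanHalf k : ℝ), by norm_num, by norm_num, by norm_num, fun k => Nat.cast_nonneg _⟩

/-- The 28 block inequalities at the Catalan weight (binding: `(1,5)`: `0.99841`, `(6,0)`: `0.99985`). [folklore] -/
theorem catW_block : BlockIneq catW := by
  intro c a hca
  have hc : c ≤ 6 := by omega
  have ha : a ≤ 6 := by omega
  interval_cases c <;> interval_cases a <;>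
    first
    | omega
    | norm_num [sum_range_succ, bwg, catW, Nat.choose, catalanHalf_zero, catalanHalf_one, catalanHalf_two, catalanHalf_three, catalanHalf_four,
        catalanHalf_five, catalanHalf_six]

/-- The root bound `G = 4/5` at the Catalan weight (`a = 6`: `0.78701`). [folklore] -/
theorem catW_root : RootBound catW (4 / 5) := by
  intro a ha
  interval_cases a <;>
    norm_num [sum_range_succ, bwg, catW, Nat.choose, catalanHalf_zero, catalanHalf_one, catalanHalf_two, catalanHalf_three, catalanHalf_four,
      catalanHalf_five, catalanHalf_six]

/-- The growth constant `(32/7)·(17/13)³ = 10.2228… ≤ 41/4`. [folklore] -/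
theorem catW_growth : (catW.x * catW.y ^ 3)⁻¹ ≤ 41 / 4 := by norm_num [catW]

/-- ★ **The Catalan-weighted Kraft tail** (19354-4's `KraftB` ∕ `DegreeWeightedTailB` shape): `Σ_X Π_ℓ Cat½(deg_X ℓ) ≤ (4/5)·(41/4)ⁿ` through every link. [folklore] -/
theorem chargedCount_catalan_le (e : ZdEdge 4) (n : ℕ) :
    ∑ X ∈ validFamily (fun _ => True) e n, ∏ l ∈ links X, (catalanHalf (atLink X l).card : ℝ) ≤ 4 / 5 * (41 / 4 : ℝ) ^ n := by
  classical
  have h := weightedCount_le catW (fun _ => True) catW_block catW_root (e := e) trivial n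
  unfold weightedCount at h
  simp_rw [charge_empty, filter_true_of_mem (fun _ _ => trivial)] at h
  exact h.trans (mul_le_mul_of_nonneg_left (pow_le_pow_left₀ (by norm_num [catW]) catW_growth n) (by norm_num))

/-- The `KraftB` form: `(Σ_X Π_ℓ Cat½(deg_X ℓ))·x^n y^{3n} ≤ 4/5` at `(x, y) = (7/32, 13/17)`. [folklore] -/
theorem chargedCount_catalan_mul_le (e : ZdEdge 4) (n : ℕ) :
    (∑ X ∈ validFamily (fun _ => True) e n, ∏ l ∈ links X, (catalanHalf (atLink X l).card : ℝ)) * ((7 / 32 : ℝ) ^ n * (13 / 17 : ℝ) ^ (3 * n)) ≤ 4 / 5 := by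
  classical
  have h := weightedCount_mul_le catW (fun _ => True) catW_block catW_root (e := e) trivial n
  unfold weightedCount at h
  simp_rw [charge_empty, filter_true_of_mem (fun _ _ => trivial)] at h
  exact h

end Summit.QuantumFields.YangMills.Theorems.Instrument.ChargedKraftInstances

end
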